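import Summits.BirchSwinnertonDyer.BirchSwinnertonDyer.Theses.GenusKolyvaginAtTwo
import Summits.BirchSwinnertonDyer.BirchSwinnertonDyer.Theorems.GenusKolyvaginAtTwoMinimalTwinBSDTwoAnalyticTwin
import HarnessLib

/-!
# LINE 23 «twin_swap» v2.4 «ANALYTIC TWIN» (THREE stubs: WALL row 1 · KEX′ · PRINT×6; NO 2-converse item, NO declared residual, no trichotomy) on crux
# hTw `MinimalTwinBSDTwo` (stmt-BirchSwinnertonDyer-22985, route `GenusKolyvaginAtTwo` rev 59)

Seat `bsd-line-gk2-p2` g27 (PROVER 2/3, cell bsd-f1-sign2, LINE 23 holder), 2026-08-30, on top of v2.3 «UNIFORM» (this seat, `Lines/twin_swap_v23_gk2p2.lean`: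
WALL + CONV₀ items + off-semistable residual + KEX + PRINT×5).  Nothing here proves BSD, U₂, the wall or KEX′.

WHAT CHANGED vs v2.3.  v2.3 certifies `r_an(Wd) = 0` for the reversed twin through `#Sel₂(Wd) = 1` and the RANK-ZERO 2-CONVERSE (items stmt-19218 +
stmt-19219 of route TwoAdicConverse + the declared residual off the semistable-ordinary locus — three beyond-print inputs).  But (i) g26's sha-depth
descent needs the twin's `2`-Selmer-triviality only for `rank W(ℚ) ≥ 1`, which is GZK (`AnalyticTwin.swappedPairDescentAtTwo_shaDepth_anyTwin_of_facts`,
p-ANALYTIC), and (ii) WALL row 1 is BSD₂ for EVERY non-CM rank-`0` curve (no Selmer clause); so the twin can be taken ANALYTICALLY: `w(W) = −1`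
(parity), and Friedberg–Hoffstein 1995 (Literature `friedbergHoffstein_exists_heegnerField_split_twist_ne_zero`, IN PRINT, statement-only) gives an
imaginary quadratic `K`, Heegner for `N_W`, `2` split, `|d_K| > 4`, with `L(W^{(d_K)},1) ≠ 0`.  So (`AnalyticTwin.bsdp_of_wall_of_friedbergHoffstein_of_kex_of_facts`):
**hTw ⟸ WALL row 1 + KEX′ + PRINT×6 (GZ, GZK, modularity, Milne, BCDT, FH)** — THREE stubs, the research one KEX′ (`HeegnerIndexRelationAnyTwinAtTwo`
below) LOSSLESS: U₂ + WALL + PRINT ⟹ KEX′ (`AnalyticTwin.kexAny_of_minimalTwinBSDTwo_of_wall_of_facts`).  KEX′ ⟹ v2.3's KEX (restriction to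
`2`-Selmer-trivial prime twins) ⟹ v2.1/v2.2's exponents (dictionary `Uniform.twoDepth_eq_…`).  BSD is NOT proved by any of this.
-/

set_option linter.dupNamespace false -- `Summit.<P>.<Sub>` repeats `BirchSwinnertonDyer` (D-0017)

namespace Summit.BirchSwinnertonDyer.BirchSwinnertonDyer.Cruxes.MinimalTwinBSDTwo.TwinSwapV24

open scoped Classical NumberField

open Summit.BirchSwinnertonDyer.BirchSwinnertonDyer.Theses.GenusKolyvaginAtTwo
open WeierstrassCurve NumberField Literature.NumberTheory.EllipticCurves Literature.NumberTheory.EllipticCurves.ModularForms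
open Summit.BirchSwinnertonDyer.BirchSwinnertonDyer.Theorems
open Summit.BirchSwinnertonDyer.BirchSwinnertonDyer.Theorems.GenusExact.TwinSwap.AnalyticTwin (bsdp_of_wall_of_friedbergHoffstein_of_kex_of_facts)
open Summit.BirchSwinnertonDyer.BirchSwinnertonDyer.Theses.ByReductionTypeAtTwo
  (GoodOrdinaryRankZeroAtTwo MultiplicativeRankZeroAtTwo SupersingularRankZeroAtTwo AdditiveRankZeroAtTwo)

/-! ## The displayed Props (S1′ = WALL row 1 without the Selmer clause; KEX′ = the ONE research statement) -/

/-- S1′ · the ANCHOR: BSD₂ for every non-CM globally minimal curve of analytic rank `0` (= WALL row 1 of route ByReductionTypeAtTwo, all four reduction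
types at `2`; no Selmer clause — the analytic twin may have `Ш(Wd)[2] ≠ 0`). -/
def RankZeroBSDTwo : Prop :=
  ∀ (W : WeierstrassCurve ℚ) [W.IsElliptic] [W.IsGloballyMinimal], ¬ W.HasCM → W.analyticRank = 0 →
    Literature.NumberTheory.EllipticCurves.BSDp W 2

/-- KEX′ · THE 2-PRIMARY GROSS–ZAGIER INDEX RELATION FOR THE RANK-ONE MEMBER AT EVERY ODD HEEGNER FRAME WITH `2` SPLIT (the ONE research statement of
v2.4; Gross's conjecture (GZ V (2.2) ⊗ BSD) at `p = 2`): for `W` non-CM globally minimal with `r_an = 1`, `#Sel₂(W) = 2`, at EVERY imaginary quadratic `K`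
(`d_K` odd `≠ −3`, Heegner for `N_W`, `2` split), EVERY globally minimal `Wd ≅ W^{(d_K)}`, `L(W^{(d_K)},1) ≠ 0`, EVERY conductor-`1` datum: SOME exact depth
`2^{M₀} ∥ P(1)` has **`#Ш(W_K)[2^∞] · 4^{ord₂ c + ord₂ C(W)} = 4^{M₀}`**.  LOSSLESS (U₂ + S1′ + PRINT ⟹ KEX′); restricts to v2.3's KEX on
`2`-Selmer-trivial prime twins. -/
def HeegnerIndexRelationAnyTwinAtTwo : Prop :=
  ∀ (W : WeierstrassCurve ℚ) [W.IsElliptic] [W.IsGloballyMinimal] [NeZero (W.conductorNorm ℤ)],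
    ¬ W.HasCM → W.analyticRank = 1 → Nat.card (W.selmerGroup 2) = 2 →
    ∀ (K : Type) [Field K] [NumberField K], IsImaginaryQuadratic K →
      Odd (NumberField.discr K) → NumberField.discr K ≠ -3 → SatisfiesHeegnerHypothesis (W.conductorNorm ℤ) K →
      ((Ideal.span {(2 : ℤ)}).primesOver (𝓞 K)).ncard = 2 →
      ∀ (Wd : WeierstrassCurve ℚ) [Wd.IsElliptic] [Wd.IsGloballyMinimal],
        (∃ C : VariableChange ℚ, C • W.quadraticTwist (NumberField.discr K : ℚ) = Wd) →
      (W.quadraticTwist (NumberField.discr K : ℚ)).entireLFunction 1 ≠ 0 →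
      ∀ (Dt : ModularParametrizationData W (W.conductorNorm ℤ)) (β : ℤ) (ι : K →+* ℂ) (d₁ : KolyvaginHeegnerData Dt β ι 1),
        ∃ M₀ : ℕ,
          (∃ Q : (W.baseChange (ringClassField K ι 1)).toAffine.Point, ((2 ^ M₀ : ℕ) : ℤ) • Q = d₁.derivedPoint) ∧
          (¬ ∃ Q : (W.baseChange (ringClassField K ι 1)).toAffine.Point, ((2 ^ (M₀ + 1) : ℕ) : ℤ) • Q = d₁.derivedPoint) ∧
          Nat.card (AddCommGroup.primaryComponent (W.baseChange K).sha 2) *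
              2 ^ (2 * (padicValInt 2 Dt.c + padicValNat 2 W.tamagawaProduct)) = 2 ^ (2 * M₀)

/-! ## The three stubs (WALL row 1 ×4 bundled · KEX′ · PRINT ×6 bundled) -/

/-- stub WALL = items `GoodOrdinaryRankZeroAtTwo` (stmt-BirchSwinnertonDyer-19095), `MultiplicativeRankZeroAtTwo`, `SupersingularRankZeroAtTwo`,
`AdditiveRankZeroAtTwo` (route ByReductionTypeAtTwo, WALL row 1) BY NAME — the anchor. -/
theorem stub_wallRankZeroAtTwo :
    GoodOrdinaryRankZeroAtTwo ∧ MultiplicativeRankZeroAtTwo ∧ SupersingularRankZeroAtTwo ∧ AdditiveRankZeroAtTwo := by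
  sorry

/-- stub KEX′ — the 2-primary Gross–Zagier index relation for the rank-one member, any odd Heegner frame with `2` split (research content = BSD₂ there mod
the rest, LOSSLESS). -/
theorem stub_heegnerIndexRelationAnyTwin : HeegnerIndexRelationAnyTwinAtTwo := by
  sorry

/-- stub PRINT = the route's four print items BY NAME — `GrossZagierAllLevels` (24148), `MultPublishedInputsAtTwo` (19921 = GZK), `EntireLFunctionRat` (19273),
`MilneAnyModel` (24149) — + BCDT `nonempty_modularParametrizationData` + Friedberg–Hoffstein `friedbergHoffstein_exists_heegnerField_split_twist_ne_zero`
(both Literature statement-only facts, in print). -/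
theorem stub_printFacts :
    GrossZagierAllLevels ∧ MultPublishedInputsAtTwo ∧ EntireLFunctionRat ∧ MilneAnyModel ∧ nonempty_modularParametrizationData ∧
      friedbergHoffstein_exists_heegnerField_split_twist_ne_zero := by
  sorry

/-! ## The closed piece: the S1′ door -/

/-- WALL row 1 (ByReductionTypeAtTwo 19095–19098) ⟹ S1′, by the reduction-type tetrachotomy at `2` (critic #414's P1 door without the Selmer clause). -/
theorem rankZeroBSDTwo_of_wall (hOrd : GoodOrdinaryRankZeroAtTwo) (hMult : MultiplicativeRankZeroAtTwo)
    (hSS : SupersingularRankZeroAtTwo) (hAdd : AdditiveRankZeroAtTwo) : RankZeroBSDTwo := by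
  intro W _ _ hCM hr
  by_cases hg : W.HasGoodReductionAtPrime 2
  · by_cases hd : ((2 : ℕ) : ℤ) ∣ W.frobeniusTrace 2
    · exact hSS W hCM hr ⟨hg, hd⟩
    · exact hOrd W hCM hr ⟨hg, hd⟩
  · by_cases hm : W.HasMultiplicativeReductionAtPrime 2
    · exact hMult W hCM hr hm
    · exact hAdd W hCM hr ⟨hg, hm⟩

/-! ## The composition -/

/-- COMPOSITION v2.4 with displayed inputs (kernel-checked, no sorry of its own): S1′ + KEX′ + PRINT×6 prove hTw BY NAME — ONE cell, no converse, no residual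
(`AnalyticTwin.bsdp_of_wall_of_friedbergHoffstein_of_kex_of_facts`: parity ⟹ `w(W) = −1`; Friedberg–Hoffstein ⟹ analytic twin; Néron minimal model;
datum; Gross–Zagier; KEX′; wall; Selmer-free sha-depth descent). -/
theorem minimalTwinBSDTwo_of_inputs (h1 : RankZeroBSDTwo) (hKEX : HeegnerIndexRelationAnyTwinAtTwo)
    (hGZ : GrossZagierAllLevels) (hGZK : MultPublishedInputsAtTwo) (hL : EntireLFunctionRat) (hMi : MilneAnyModel)
    (hMP : nonempty_modularParametrizationData) (hFH : friedbergHoffstein_exists_heegnerField_split_twist_ne_zero) :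
    -- (= `MinimalTwinBSDTwo` unfolded, so that `MinimalTwinBSDTwo_of` below is the FIRST theorem concluding the crux decl by name)
    ∀ (W : WeierstrassCurve ℚ) [W.IsElliptic] [W.IsGloballyMinimal],
      ¬ W.HasCM → W.analyticRank = 1 → Nat.card (W.selmerGroup 2) = 2 → Literature.NumberTheory.EllipticCurves.BSDp W 2 :=
  bsdp_of_wall_of_friedbergHoffstein_of_kex_of_facts hGZ hGZK hL hMi hMP hFH h1 hKEX

/-- **THE LINE CONCLUDES THE CRUX BY NAME**: `MinimalTwinBSDTwo` (stmt-BirchSwinnertonDyer-22985) from the three stubs — WALL row 1 (items, bundled), KEX′,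
PRINT×6 (bundled).  Sorry-free outside the stubs; no converse, no residual locus. -/
theorem MinimalTwinBSDTwo_of : Summit.BirchSwinnertonDyer.BirchSwinnertonDyer.Theses.GenusKolyvaginAtTwo.MinimalTwinBSDTwo :=
  minimalTwinBSDTwo_of_inputs
    (rankZeroBSDTwo_of_wall stub_wallRankZeroAtTwo.1 stub_wallRankZeroAtTwo.2.1 stub_wallRankZeroAtTwo.2.2.1 stub_wallRankZeroAtTwo.2.2.2)
    stub_heegnerIndexRelationAnyTwin
    stub_printFacts.1 stub_printFacts.2.1 stub_printFacts.2.2.1 stub_printFacts.2.2.2.1 stub_printFacts.2.2.2.2.1 stub_printFacts.2.2.2.2.2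

end Summit.BirchSwinnertonDyer.BirchSwinnertonDyer.Cruxes.MinimalTwinBSDTwo.TwinSwapV24
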